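import Summits.AtomisticToContinuum.HydrodynamicLimit.Theses.CollisionIsometryCLT
import Literature.Analysis.FluidPDE.HardSphereFlowOrbits
import Literature.Analysis.FluidPDE.HardSphereFlowRegular

/-!
# `TransferRepresentsFlow` (route CollisionIsometryCLT, support item stmt-AtomisticToContinuum-12952)

The route `CollisionIsometryCLT` types the *velocity transfer* `M N y Δ` of the hard-sphere gas as a
fold, over the first `collisionCount y Δ` steps of the in-tree collision-by-collision construction
(`Literature.Analysis.FluidPDE.Alexander.*`, CIP 1994 App. 4.A), of the linear elastic reflections
`collidePair` evaluated at the realised pre-collisional positions. This file proves the support item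
`TransferRepresentsFlow`: for `0 < σ < 1/2`, every `N`, every hard-sphere flow `Φ` of `N + 1` spheres of
diameter `hsDiameter σ N` on `𝕋³`, every `s` and every `Δ ≥ 0`, for Liouville-a.e. `z` the velocities of
`Φ_{s+Δ} z` are `M N (Φ_s z) Δ` applied to the velocities of `Φ_s z`.

Proof.
* `foldStep_snd_eq_collisionStep_snd`: one fold step applied to the velocities of a configuration `z`
  returns the velocities of `Alexander.collisionStep z` — definitional away from the missing
  `freeExitTime = ∞` guard of the fold, where `S_0 z = z` has no incoming contact pair because an
  incoming contact pair forces `τ = 0` (`Alexander.freeExitTime_eq_zero_of_isIncoming`, regular torus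
  geometry `ε < 1/2`).
* `transferFold_snd_eq_stateAfter_snd`: by induction, the fold over `range m` started at the velocities
  of `y` gives the velocities of the `m`-th post-collisional state `Alexander.stateAfter y m`, for EVERY
  `y` and `m`; free flight keeps velocities, so the velocities of `Alexander.fwdFlow y Δ` are the fold
  over `collisionCount y Δ` steps.
* `transferRepresentsFlow_proof`: every hard-sphere flow on the torus agrees Liouville-a.e., at each
  fixed time, with the regularised Alexander flow (`HardSphereFlow.flow_ae_eq_regFlow`, forward
  uniqueness of hard-sphere trajectories, GST 2013 Prop. 4.1.1), which is a group everywhere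
  (`Alexander.regFlow_add`) and maps the conull good set to itself; hence a.e.
  `Φ_{s+Δ} z = T^Δ (Φ_s z) = fwdFlow (Φ_s z) Δ`.

A candidate proof of the same statement (through verbatim copies of a line skeleton's definitions) was
attached by the disprover of crux `AdaptedWeightCLT`
(`Cruxes/AdaptedWeightCLT/DrefuteFoldDictionary.lean`); this file is its definition-free landing.

References: C. Cercignani, R. Illner, M. Pulvirenti, *The Mathematical Theory of Dilute Gases* (1994),
§4.2 and App. 4.A; I. Gallagher, L. Saint-Raymond, B. Texier, *From Newton to Boltzmann* (2013),
Prop. 4.1.1; R. K. Alexander, PhD thesis (1975).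
-/

namespace Summit.AtomisticToContinuum.HydrodynamicLimit.Theorems

open scoped ENNReal
open Filter Set MeasureTheory
open Literature.Analysis.FluidPDE Literature.MathematicalPhysics.KineticTheory

/-- **One fold step is one collision step (velocities).** For a configuration `z` of `n` spheres of
diameter `ε < 1/2` on the flat torus `𝕋^d`, let `z' = S_{τ(z)} z` be the free flight of `z` up to its
exit time. The fold step of the route's transfer — reflect, by `collidePair` at the chosen incoming
contact pair of `z'`, the configuration with the positions of `z'` and the given velocities, if such a
pair exists — applied to the velocities of `z` yields the velocities of `Alexander.collisionStep z`.
If `τ(z) = ∞` the collision step is the identity and `z' = z` has no incoming contact pair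
(`Alexander.freeExitTime_eq_zero_of_isIncoming`). [folklore; CIP 1994 App. 4.A p. 111] -/
theorem foldStep_snd_eq_collisionStep_snd {d : Type*} [Fintype d] {ε : ℝ} (hε : ε < 2⁻¹) {n : ℕ}
    (z : Config n d (UnitAddTorus d)) :
    @dite (Fin n → EuclideanSpace ℝ d)
        (Alexander.incomingPairs (Torus.geometry d) ε
          (freeFlight (Torus.geometry d)
            (Alexander.freeExitTime (Torus.geometry d) ε z).toReal z)).Nonempty
        (Classical.propDecidable _)
        (fun h => fun i => (collidePair (Torus.geometry d) h.some.1 h.some.2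
          (fun j => ((freeFlight (Torus.geometry d)
            (Alexander.freeExitTime (Torus.geometry d) ε z).toReal z j).1, (z j).2)) i).2)
        (fun _ => fun i => (z i).2)
      = fun i => (Alexander.collisionStep (Torus.geometry d) ε z i).2 := by
  -- the configuration handed to `collidePair` is the pre-collisional configuration `S_{τ(z)} z`
  have hW : (fun j => ((freeFlight (Torus.geometry d)
      (Alexander.freeExitTime (Torus.geometry d) ε z).toReal z j).1, (z j).2))
        = freeFlight (Torus.geometry d) (Alexander.freeExitTime (Torus.geometry d) ε z).toReal z := by
    funext j
    rfl
  rw [hW]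
  by_cases hτ : Alexander.freeExitTime (Torus.geometry d) ε z = ∞
  · -- terminal state: the collision step is the identity and `S_0 z = z` has no incoming pair
    rw [Alexander.collisionStep_of_eq_top hτ]
    have h0 : freeFlight (Torus.geometry d)
        (Alexander.freeExitTime (Torus.geometry d) ε z).toReal z = z := by
      rw [hτ, ENNReal.toReal_top, freeFlight_zero]
    rw [h0]
    have hno : ¬ (Alexander.incomingPairs (Torus.geometry d) ε z).Nonempty := by
      rintro ⟨p, hlt, hc, hin⟩
      have h := Alexander.freeExitTime_eq_zero_of_isIncoming
        (Torus.isHardSphereRegular_geometry (d := d) hε) (ne_of_lt hlt) hc hin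
      rw [h] at hτ
      exact ENNReal.zero_ne_top hτ
    rw [dif_neg hno]
  · rw [Alexander.collisionStep, if_neg hτ]
    by_cases h : (Alexander.incomingPairs (Torus.geometry d) ε
        (freeFlight (Torus.geometry d)
          (Alexander.freeExitTime (Torus.geometry d) ε z).toReal z)).Nonempty
    · rw [dif_pos h]
      funext i
      simp only [dif_pos h]
    · rw [dif_neg h]
      funext i
      simp only [dif_neg h, freeFlight_apply]

/-- **The typed transfer fold is Alexander's construction (velocities), for every configuration.**
For `ε < 1/2`, every configuration `y` of `n` spheres on `𝕋^d` and every `m`, folding the first `m`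
transfer steps (step `k` reflects at the incoming contact pair of the pre-collisional configuration
`S_{τ(z_k)} z_k`, `z_k = Alexander.stateAfter y k`) over the velocities of `y` gives the velocities of
the `m`-th post-collisional state `z_m` (induction on `m` with `foldStep_snd_eq_collisionStep_snd`
and `z_{m+1} = collisionStep z_m`). [folklore; CIP 1994 App. 4.A p. 109] -/
theorem transferFold_snd_eq_stateAfter_snd {d : Type*} [Fintype d] {ε : ℝ} (hε : ε < 2⁻¹) {n : ℕ}
    (y : Config n d (UnitAddTorus d)) (m : ℕ) :
    (List.range m).foldl (fun (W' : Fin n → EuclideanSpace ℝ d) (k : ℕ) =>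
        @dite (Fin n → EuclideanSpace ℝ d)
          (Alexander.incomingPairs (Torus.geometry d) ε
            (freeFlight (Torus.geometry d)
              (Alexander.freeExitTime (Torus.geometry d) ε
                (Alexander.stateAfter (Torus.geometry d) ε y k)).toReal
              (Alexander.stateAfter (Torus.geometry d) ε y k))).Nonempty
          (Classical.propDecidable _)
          (fun h => fun i => (collidePair (Torus.geometry d) h.some.1 h.some.2
            (fun j => ((freeFlight (Torus.geometry d)
              (Alexander.freeExitTime (Torus.geometry d) ε
                (Alexander.stateAfter (Torus.geometry d) ε y k)).toReal
              (Alexander.stateAfter (Torus.geometry d) ε y k) j).1, W' j)) i).2)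
          (fun _ => W'))
      (fun i => (y i).2)
    = fun i => (Alexander.stateAfter (Torus.geometry d) ε y m i).2 := by
  induction m with
  | zero => rfl
  | succ m ih =>
    rw [List.range_succ, List.foldl_append, List.foldl_cons, List.foldl_nil, ih]
    refine (foldStep_snd_eq_collisionStep_snd hε
      (Alexander.stateAfter (Torus.geometry d) ε y m)).trans ?_
    funext i
    rw [Alexander.stateAfter_succ]

/-- **Velocities of the forward flow are the transfer fold over `collisionCount` steps.** For
`ε < 1/2` and every configuration `y` on `𝕋^d`, the velocities of `Alexander.fwdFlow y Δ` (free
flight from the last post-collisional state `z_K`, `K = collisionCount y Δ`; free flight keeps the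
velocities) are the fold of the first `K` transfer steps applied to the velocities of `y`.
[folklore; CIP 1994 §4.2 p. 65] -/
theorem transferFold_snd_eq_fwdFlow_snd {d : Type*} [Fintype d] {ε : ℝ} (hε : ε < 2⁻¹) {n : ℕ}
    (y : Config n d (UnitAddTorus d)) (Δ : ℝ) :
    (List.range (Alexander.collisionCount (Torus.geometry d) ε y Δ)).foldl
        (fun (W' : Fin n → EuclideanSpace ℝ d) (k : ℕ) =>
        @dite (Fin n → EuclideanSpace ℝ d)
          (Alexander.incomingPairs (Torus.geometry d) ε
            (freeFlight (Torus.geometry d)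
              (Alexander.freeExitTime (Torus.geometry d) ε
                (Alexander.stateAfter (Torus.geometry d) ε y k)).toReal
              (Alexander.stateAfter (Torus.geometry d) ε y k))).Nonempty
          (Classical.propDecidable _)
          (fun h => fun i => (collidePair (Torus.geometry d) h.some.1 h.some.2
            (fun j => ((freeFlight (Torus.geometry d)
              (Alexander.freeExitTime (Torus.geometry d) ε
                (Alexander.stateAfter (Torus.geometry d) ε y k)).toReal
              (Alexander.stateAfter (Torus.geometry d) ε y k) j).1, W' j)) i).2)
          (fun _ => W'))
      (fun i => (y i).2)
    = fun i => (Alexander.fwdFlow (Torus.geometry d) ε y Δ i).2 :=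
  transferFold_snd_eq_stateAfter_snd hε y _

/-- **`TransferRepresentsFlow` (item stmt-AtomisticToContinuum-12952 of route CollisionIsometryCLT),
proved.** For `0 < σ < 1/2`, every `N`, every hard-sphere flow `Φ` of `N + 1` spheres of diameter
`hsDiameter σ N` on `𝕋³`, every `s` and every `Δ ≥ 0`: for Liouville-a.e. `z`, the velocities of
`Φ.flow (s + Δ) z` are the typed transfer `M N (Φ.flow s z) Δ` applied to the velocities of
`Φ.flow s z`. Proof: `Φ_t = regFlow t` a.e. at `t = s` and `t = s + Δ`
(`HardSphereFlow.flow_ae_eq_regFlow`: forward uniqueness of hard-sphere trajectories), a.e. `z` is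
good (`Alexander.torusFlow_ae_good_holds`) so `Φ_s z = regFlow s z` is good, the everywhere group law
`Alexander.regFlow_add` gives `Φ_{s+Δ} z = T^Δ (Φ_s z) = fwdFlow (Φ_s z) Δ`, and
`transferFold_snd_eq_fwdFlow_snd` identifies its velocities with the fold.
[folklore; GST 2013 Prop. 4.1.1; CIP 1994 Thm. 4.2.1, App. 4.A] -/
theorem transferRepresentsFlow_proof :
    Summit.AtomisticToContinuum.HydrodynamicLimit.Theses.CollisionIsometryCLT.TransferRepresentsFlow := by
  intro σ hσ hσ' M N Φ s Δ hΔ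
  have hε0 : 0 < hsDiameter σ N := hsDiameter_pos hσ N
  have hε : hsDiameter σ N < 2⁻¹ := (hsDiameter_le hσ.le N).trans_lt hσ'
  have hgood : ∀ᵐ z ∂(liouville (Torus.geometry (Fin 3)) (N + 1) (hsDiameter σ N)),
      z ∈ Alexander.good (N := N + 1) (Torus.geometry (Fin 3)) (hsDiameter σ N) :=
    mem_ae_iff.2 (Alexander.torusFlow_ae_good_holds (d := Fin 3) hε0 hε (N + 1))
  filter_upwards [Φ.flow_ae_eq_regFlow hε0 hε s, Φ.flow_ae_eq_regFlow hε0 hε (s + Δ), hgood]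
    with z hzs hzsΔ hz
  -- `Φ_s z = regFlow s z` is a good configuration
  have hy : Φ.flow s z ∈ Alexander.good (Torus.geometry (Fin 3)) (hsDiameter σ N) := by
    rw [hzs]
    exact Alexander.mapsTo_regFlow_good hε0 hε s hz
  -- `Φ_{s+Δ} z = T^Δ (Φ_s z) = fwdFlow (Φ_s z) Δ`
  have hflow : Φ.flow (s + Δ) z
      = Alexander.fwdFlow (Torus.geometry (Fin 3)) (hsDiameter σ N) (Φ.flow s z) Δ := by
    rw [hzsΔ, add_comm s Δ, Alexander.regFlow_add hε0 hε Δ s z, ← hzs, Alexander.regFlow_of_mem hy,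
      Alexander.flow_of_nonneg hΔ]
  rw [hflow]
  exact (transferFold_snd_eq_fwdFlow_snd (d := Fin 3) hε (Φ.flow s z) Δ).symm


/-! ### Uniform-in-time form of the dictionary (appended 2026-08-16)

The item above fixes `(s, Δ)` before discarding a null set. The line `contact-source-duhamel` of crux
`AdaptedWeightCLT` (stub `stub_flowDictionary`) consumes the stronger form in which ONE null set serves
all `s ∈ ℝ` and all `Δ ≥ 0`; it follows from forward uniqueness of hard-sphere trajectories restarted
at the rational times of the orbit. -/

/-- **A hard-sphere flow on the torus is Alexander's forward flow restarted anywhere on almost every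
orbit.** For `0 < ε < 1/2` and every hard-sphere flow `Φ` of `n` spheres of diameter `ε` on `𝕋^d`:
for Liouville-a.e. `z`, simultaneously for all `s ∈ ℝ` and all `Δ ≥ 0`,
`Φ_{s+Δ} z = fwdFlow (Φ_s z) Δ` (the collision-by-collision forward flow of CIP 1994 App. 4.A started
at `Φ_s z`). Proof: on the conull set `Φ.good ∩ ⋂_{q ∈ ℚ} Φ_q⁻¹ Γ₀` (`Γ₀ = Alexander.good` is conull,
`Alexander.torusFlow_ae_good_holds`, and each `Φ_q` preserves the Liouville measure) pick a rational
`q < s`; forward uniqueness (`IsHardSphereTrajectory.unique_holds`, GST 2013 Prop. 4.1.1) identifies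
`u ↦ Φ_u (Φ_q z)` with `u ↦ T^u (Φ_q z)` on `u ≥ 0` (`Alexander.torusFlow_isTrajectory_holds`), and
the group law of `T` on `Γ₀` (`Alexander.torusFlow_group_holds`) gives
`Φ_{s+Δ} z = T^{s+Δ-q} (Φ_q z) = T^Δ (T^{s-q} (Φ_q z)) = T^Δ (Φ_s z)`.
[folklore; GST 2013 Prop. 4.1.1; CIP 1994 §4.2 p. 65] -/
theorem ae_forall_flow_add_eq_fwdFlow {d : Type*} [Fintype d] {ε : ℝ} (hε0 : 0 < ε) (hε : ε < 2⁻¹)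
    {n : ℕ} (Φ : HardSphereFlow (Torus.geometry d) ε n) :
    ∀ᵐ z ∂(liouville (Torus.geometry d) n ε), ∀ s Δ : ℝ, 0 ≤ Δ →
      Φ.flow (s + Δ) z = Alexander.fwdFlow (Torus.geometry d) ε (Φ.flow s z) Δ := by
  obtain ⟨-, hzero, hadd⟩ := Alexander.torusFlow_group_holds (d := d) hε0 hε n
  have htraj := Alexander.torusFlow_isTrajectory_holds (d := d) hε0 hε n
  have haegood : ∀ᵐ z ∂(liouville (Torus.geometry d) n ε),
      z ∈ Alexander.good (N := n) (Torus.geometry d) ε :=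
    mem_ae_iff.2 (Alexander.torusFlow_ae_good_holds (d := d) hε0 hε n)
  have hall : ∀ᵐ z ∂(liouville (Torus.geometry d) n ε),
      ∀ q : ℚ, Φ.flow (q : ℝ) z ∈ Alexander.good (N := n) (Torus.geometry d) ε :=
    ae_all_iff.2 fun q => (Φ.measurePreserving (q : ℝ)).quasiMeasurePreserving.ae haegood
  filter_upwards [Φ.ae_mem_good, hall] with z hz hq
  intro s Δ hΔ
  obtain ⟨q, hqs⟩ := exists_rat_lt s
  have hwgood : Φ.flow (q : ℝ) z ∈ Φ.good := Φ.mapsTo_good (q : ℝ) hz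
  have hwA := hq q
  -- forward uniqueness from the good configuration `w = Φ_q z`
  have hEq : EqOn (fun u => Φ.flow u (Φ.flow (q : ℝ) z))
      (fun u => Alexander.flow (Torus.geometry d) ε u (Φ.flow (q : ℝ) z)) (Ici 0) := by
    refine IsHardSphereTrajectory.unique_holds (Φ.isTrajectory _ hwgood) (htraj _ hwA) ?_
    show Φ.flow 0 (Φ.flow (q : ℝ) z) = Alexander.flow (Torus.geometry d) ε 0 (Φ.flow (q : ℝ) z)
    rw [Φ.flow_zero _ hwgood, hzero _ hwA]
  have hs : Φ.flow s z = Alexander.flow (Torus.geometry d) ε (s - q) (Φ.flow (q : ℝ) z) := by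
    calc Φ.flow s z = Φ.flow ((s - q) + q) z := by rw [sub_add_cancel]
      _ = Φ.flow (s - q) (Φ.flow (q : ℝ) z) := Φ.flow_add (s - q) q z hz
      _ = Alexander.flow (Torus.geometry d) ε (s - q) (Φ.flow (q : ℝ) z) :=
          hEq (show (s - q : ℝ) ∈ Ici (0 : ℝ) from Set.mem_Ici.2 (by linarith))
  calc Φ.flow (s + Δ) z = Φ.flow ((s + Δ - q) + q) z := by rw [sub_add_cancel]
    _ = Φ.flow (s + Δ - q) (Φ.flow (q : ℝ) z) := Φ.flow_add (s + Δ - q) q z hz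
    _ = Alexander.flow (Torus.geometry d) ε (s + Δ - q) (Φ.flow (q : ℝ) z) :=
        hEq (show (s + Δ - q : ℝ) ∈ Ici (0 : ℝ) from Set.mem_Ici.2 (by linarith))
    _ = Alexander.flow (Torus.geometry d) ε (Δ + (s - q)) (Φ.flow (q : ℝ) z) := by
        rw [show (s + Δ - q : ℝ) = Δ + (s - q) by ring]
    _ = Alexander.flow (Torus.geometry d) ε Δ
          (Alexander.flow (Torus.geometry d) ε (s - q) (Φ.flow (q : ℝ) z)) := hadd Δ (s - q) _ hwA
    _ = Alexander.flow (Torus.geometry d) ε Δ (Φ.flow s z) := by rw [hs]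
    _ = Alexander.fwdFlow (Torus.geometry d) ε (Φ.flow s z) Δ := Alexander.flow_of_nonneg hΔ _

/-- **Uniform-in-time velocity dictionary** (the content of stub `stub_flowDictionary` of the line
`contact-source-duhamel` of crux `AdaptedWeightCLT`, stmt-AtomisticToContinuum-12949, for every
`𝕋^d` and `0 < ε < 1/2`): for every hard-sphere flow `Φ` of `n` spheres on `𝕋^d`, for Liouville-a.e.
`z`, simultaneously for all `s ∈ ℝ` and `Δ ≥ 0`, the velocities of `Φ_{s+Δ} z` are the transfer fold
over the first `collisionCount (Φ_s z) Δ` steps of the Alexander construction restarted at `Φ_s z`,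
applied to the velocities of `Φ_s z` (`ae_forall_flow_add_eq_fwdFlow` and
`transferFold_snd_eq_fwdFlow_snd`). [folklore; GST 2013 Prop. 4.1.1; CIP 1994 App. 4.A] -/
theorem ae_forall_flow_snd_eq_transferFold {d : Type*} [Fintype d] {ε : ℝ} (hε0 : 0 < ε)
    (hε : ε < 2⁻¹) {n : ℕ} (Φ : HardSphereFlow (Torus.geometry d) ε n) :
    ∀ᵐ z ∂(liouville (Torus.geometry d) n ε), ∀ s Δ : ℝ, 0 ≤ Δ →
      (fun i => (Φ.flow (s + Δ) z i).2)
        = (List.range (Alexander.collisionCount (Torus.geometry d) ε (Φ.flow s z) Δ)).foldl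
            (fun (W' : Fin n → EuclideanSpace ℝ d) (k : ℕ) =>
            @dite (Fin n → EuclideanSpace ℝ d)
              (Alexander.incomingPairs (Torus.geometry d) ε
                (freeFlight (Torus.geometry d)
                  (Alexander.freeExitTime (Torus.geometry d) ε
                    (Alexander.stateAfter (Torus.geometry d) ε (Φ.flow s z) k)).toReal
                  (Alexander.stateAfter (Torus.geometry d) ε (Φ.flow s z) k))).Nonempty
              (Classical.propDecidable _)
              (fun h => fun i => (collidePair (Torus.geometry d) h.some.1 h.some.2
                (fun j => ((freeFlight (Torus.geometry d)
                  (Alexander.freeExitTime (Torus.geometry d) ε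
                    (Alexander.stateAfter (Torus.geometry d) ε (Φ.flow s z) k)).toReal
                  (Alexander.stateAfter (Torus.geometry d) ε (Φ.flow s z) k) j).1, W' j)) i).2)
              (fun _ => W'))
          (fun i => (Φ.flow s z i).2) := by
  filter_upwards [ae_forall_flow_add_eq_fwdFlow hε0 hε Φ] with z hz
  intro s Δ hΔ
  rw [hz s Δ hΔ]
  exact (transferFold_snd_eq_fwdFlow_snd hε (Φ.flow s z) Δ).symm

end Summit.AtomisticToContinuum.HydrodynamicLimit.Theorems
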